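import Mathlib.Data.Real.Basic
import Mathlib.Tactic.Linarith
import Mathlib.Tactic.Positivity
import Mathlib.Tactic.FieldSimp
import HarnessLib
import HarnessLib.Audit

/-!
# `NoHeavyLowerTail` (crux stmt-CriticalPhenomena-4575), Sahi programme P4 (Holley / monotone coupling):
# the maj-slot certificate on the pattern `2³` — V: the sixteen automatic pair inequalities

Support file (cell `prim-l12`, seat P4, generation 9; `--supports stmt-CriticalPhenomena-4575`).  No named facts, no
sorries; standard axioms; pure real algebra.  The proofs are machine-found certificates: every item is closed by `linarith` from an
explicit nonnegative combination of the listed facts (an exact rational Positivstellensatz-type certificate found by linear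
programming over products of the facts with nonnegative aggregate masses, verified in exact arithmetic before emission; generator
and certificates in HOME prim-l12-p4/code/gen9, memo FROM-prim-l12-p4-gen9-MAJ-SLOT-LEAN.md).

Setting (memo HOME prim-l12-p4/FROM-prim-l12-p4-gen8-PATTERN-CERTIFICATES.md §4b): the pattern `2³` of three join-primes with the
majority slot `MAJ = {ij, ik, jk, ⊤}`; for a labelling `(i, j, k)` of the atoms the eight fibre masses are `nE, ni, nj, nk, nij,
nik, njk, nT` with total `Z` (kept as a symbol; `d = nE+ni+nj+nk`, `u = nij+nik+njk+nT`, NOT normalised); the hypotheses are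
consequences of log-supermodularity of the pattern measure (`…SahiE3MajPatternFacts.facts_of_pattern`); the conclusions are the
validity / up-transport / pair inequalities for retained masses `rij, rik, rjk, rT` (homogeneous of degree three) consumed by
`…SahiE3MajPattern.certificate_of_ineqs`.  Regimes: A (top full, uniform rank-2 fill), A'(k) (top full, Hall(k) tight), B1 (top
only), B2(k) (donors of k drained) — HOME memo §4b; the case analysis is `…SahiE3MajCore.exists_cert`.
-/

namespace Summit.CriticalPhenomena.PercolationContinuityZ3.Theorems.SahiE3MajCert

/-- **The sixteen automatic pair inequalities** (traces `{⊤}` against `{⊤}, ↑(xy), ↑x`; `↑(xy)` against itself and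
        `↑x, ↑y`): they follow from up-transport of the traces `{⊤}`, `{xy, ⊤}` alone (`need ≤ Z²·(trace mass)`).
        [this work] -/
theorem cert_auto (nE ni nj nk nij nik njk nT Z : ℝ) (rij rik rjk rT : ℝ)
    (h_nn_E : 0 ≤ nE) (h_nn_0 : 0 ≤ ni) (h_nn_1 : 0 ≤ nj) (h_nn_2 : 0 ≤ nk) (h_nn_01 : 0 ≤ nij) (h_nn_02 : 0 ≤ nik)
    (h_nn_12 : 0 ≤ njk) (h_nn_T : 0 ≤ nT) (h_nn_Z : 0 ≤ Z) (h_sum : Z = nE + ni + nj + nk + nij + nik + njk + nT)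
    (h_ut_T : Z * Z * nT ≤ rT) (h_ut_01 : Z * Z * (nij + nT) ≤ rij + rT) (h_ut_02 : Z * Z * (nik + nT) ≤ rik + rT)
    (h_ut_12 : Z * Z * (njk + nT) ≤ rjk + rT) :
    Z * (nT * nT + nT * nT) - (nij + nik + njk + nT) * nT * nT ≤ rT ∧
    Z * (nT * (nij + nT) + (nij + nT) * nT) -
            (nij + nik + njk + nT) * nT * (nij + nT) ≤ rT ∧
    Z * (nT * (nik + nT) + (nik + nT) * nT) -
            (nij + nik + njk + nT) * nT * (nik + nT) ≤ rT ∧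
    Z * (nT * (njk + nT) + (njk + nT) * nT) -
            (nij + nik + njk + nT) * nT * (njk + nT) ≤ rT ∧
    Z *
            (nT * (nij + nik + nT) + (ni + nij + nik + nT) * nT) - (nij + nik + njk + nT) * nT *
            (ni + nij + nik + nT) ≤ rT ∧
    Z * (nT * (nij + njk + nT) + (nj + nij + njk + nT) * nT) -
            (nij + nik + njk + nT) * nT * (nj + nij + njk + nT) ≤ rT ∧
    Z *
            (nT * (nik + njk + nT) + (nk + nik + njk + nT) * nT) - (nij + nik + njk + nT) * nT *
            (nk + nik + njk + nT) ≤ rT ∧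
    Z * ((nij + nT) * (nij + nT) + (nij + nT) * (nij + nT)) -
            (nij + nik + njk + nT) * (nij + nT) * (nij + nT) ≤ rij + rT ∧
    Z *
            ((nik + nT) * (nik + nT) + (nik + nT) * (nik + nT)) - (nij + nik + njk + nT) * (nik + nT) * (nik + nT)
            ≤ rik + rT ∧
    Z * ((njk + nT) * (njk + nT) + (njk + nT) * (njk + nT)) - (nij + nik + njk + nT) *
            (njk + nT) * (njk + nT) ≤ rjk + rT ∧
    Z * ((nij + nT) * (nij + nik + nT) + (ni + nij + nik + nT) *
            (nij + nT)) - (nij + nik + njk + nT) * (nij + nT) * (ni + nij + nik + nT) ≤ rij + rT ∧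
    Z *
            ((nij + nT) * (nij + njk + nT) + (nj + nij + njk + nT) * (nij + nT)) - (nij + nik + njk + nT) *
            (nij + nT) * (nj + nij + njk + nT) ≤ rij + rT ∧
    Z *
            ((nik + nT) * (nij + nik + nT) + (ni + nij + nik + nT) * (nik + nT)) - (nij + nik + njk + nT) *
            (nik + nT) * (ni + nij + nik + nT) ≤ rik + rT ∧
    Z *
            ((nik + nT) * (nik + njk + nT) + (nk + nik + njk + nT) * (nik + nT)) - (nij + nik + njk + nT) *
            (nik + nT) * (nk + nik + njk + nT) ≤ rik + rT ∧
    Z *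
            ((njk + nT) * (nij + njk + nT) + (nj + nij + njk + nT) * (njk + nT)) - (nij + nik + njk + nT) *
            (njk + nT) * (nj + nij + njk + nT) ≤ rjk + rT ∧
    Z *
            ((njk + nT) * (nik + njk + nT) + (nk + nik + njk + nT) * (njk + nT)) - (nij + nik + njk + nT) *
            (njk + nT) * (nk + nik + njk + nT) ≤ rjk + rT := by
  refine ⟨?_, ?_, ?_, ?_, ?_, ?_, ?_, ?_, ?_, ?_, ?_, ?_, ?_, ?_, ?_, ?_⟩
  · -- pair_T_T
    linarith only [h_ut_T, congrArg (fun z : ℝ => ((1 : ℝ) * nE * nT + (1 : ℝ) * nT * Z + (-1 : ℝ) * nT * nT +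
            (1 : ℝ) * ni * nT + (1 : ℝ) * nj * nT + (1 : ℝ) * nk * nT) * z) h_sum,
            (by positivity : (0:ℝ) ≤ (1 : ℝ) * nT * (nij + nik + njk) * (Z + nE + ni + nj + nk) + (1 : ℝ) * nT *
            (nE + ni + nj + nk) * (nE + ni + nj + nk))]
  · -- pair_T_P01
    linarith only [h_ut_T, congrArg (fun z : ℝ => ((1 : ℝ) * nE * nT + (1 : ℝ) * nT * Z + (-1 : ℝ) * nT * nT +
            (1 : ℝ) * ni * nT + (-1 : ℝ) * nij * nT + (1 : ℝ) * nj * nT + (1 : ℝ) * nk * nT) * z) h_sum,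
            (by positivity : (0:ℝ) ≤ (1 : ℝ) * nT * (nE + ni + nj + nk) * (nE + ni + nj + nk) + (1 : ℝ) * nT *
            (nik + njk) * (Z + nE + ni + nj + nk))]
  · -- pair_T_P02
    linarith only [h_ut_T, congrArg (fun z : ℝ => ((1 : ℝ) * nE * nT + (1 : ℝ) * nT * Z + (-1 : ℝ) * nT * nT +
            (1 : ℝ) * ni * nT + (-1 : ℝ) * nik * nT + (1 : ℝ) * nj * nT + (1 : ℝ) * nk * nT) * z) h_sum,
            (by positivity : (0:ℝ) ≤ (1 : ℝ) * nT * (nE + ni + nj + nk) * (nE + ni + nj + nk) + (1 : ℝ) * nT *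
            (nij + njk) * (Z + nE + ni + nj + nk))]
  · -- pair_T_P12
    linarith only [h_ut_T, congrArg (fun z : ℝ => ((1 : ℝ) * nE * nT + (1 : ℝ) * nT * Z + (-1 : ℝ) * nT * nT +
            (1 : ℝ) * ni * nT + (1 : ℝ) * nj * nT + (-1 : ℝ) * njk * nT + (1 : ℝ) * nk * nT) * z) h_sum,
            (by positivity : (0:ℝ) ≤ (1 : ℝ) * nT * (nE + ni + nj + nk) * (nE + ni + nj + nk) + (1 : ℝ) * nT *
            (nij + nik) * (Z + nE + ni + nj + nk))]
  · -- pair_T_R0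
    linarith only [h_ut_T, congrArg (fun z : ℝ => ((1 : ℝ) * nE * nT + (1 : ℝ) * nT * Z + (-1 : ℝ) * nT * nT +
            (-1 : ℝ) * nij * nT + (-1 : ℝ) * nik * nT + (1 : ℝ) * nj * nT + (1 : ℝ) * nk * nT) * z) h_sum,
            (by positivity : (0:ℝ) ≤ (1 : ℝ) * nT * (nE + ni + nj + nk) * (nE + nj + nk + njk) + (1 : ℝ) * njk * nT
            * Z)]
  · -- pair_T_R1
    linarith only [h_ut_T, congrArg (fun z : ℝ => ((1 : ℝ) * nE * nT + (1 : ℝ) * nT * Z + (-1 : ℝ) * nT * nT +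
            (1 : ℝ) * ni * nT + (-1 : ℝ) * nij * nT + (-1 : ℝ) * njk * nT + (1 : ℝ) * nk * nT) * z) h_sum,
            (by positivity : (0:ℝ) ≤ (1 : ℝ) * nT * (nE + ni + nj + nk) * (nE + ni + nk + nik) + (1 : ℝ) * nik * nT
            * Z)]
  · -- pair_T_R2
    linarith only [h_ut_T, congrArg (fun z : ℝ => ((1 : ℝ) * nE * nT + (1 : ℝ) * nT * Z + (-1 : ℝ) * nT * nT +
            (1 : ℝ) * ni * nT + (-1 : ℝ) * nik * nT + (1 : ℝ) * nj * nT + (-1 : ℝ) * njk * nT) * z) h_sum,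
            (by positivity : (0:ℝ) ≤ (1 : ℝ) * nT * (nE + ni + nj + nk) * (nE + ni + nj) + (1 : ℝ) * nij * nT *
            (Z + nE + ni + nj + nk))]
  · -- pair_P01_P01
    linarith only [h_ut_01, congrArg (fun z : ℝ => ((1 : ℝ) * nE * nT + (1 : ℝ) * nE * nij + (1 : ℝ) * nT * Z +
            (-1 : ℝ) * nT * nT + (1 : ℝ) * ni * nT + (1 : ℝ) * ni * nij + (1 : ℝ) * nij * Z + (-2 : ℝ) * nij * nT +
            (-1 : ℝ) * nij * nij + (1 : ℝ) * nj * nT + (1 : ℝ) * nj * nij + (1 : ℝ) * nk * nT + (1 : ℝ) * nk * nij)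
            * z) h_sum, (by positivity : (0:ℝ) ≤ (1 : ℝ) * (nE + ni + nj + nk) * (nE + ni + nj + nk) * (nij + nT) +
            (1 : ℝ) * (nik + njk) * (nij + nT) * (Z + nE + ni + nj + nk))]
  · -- pair_P02_P02
    linarith only [h_ut_02, congrArg (fun z : ℝ => ((1 : ℝ) * nE * nT + (1 : ℝ) * nE * nik + (1 : ℝ) * nT * Z +
            (-1 : ℝ) * nT * nT + (1 : ℝ) * ni * nT + (1 : ℝ) * ni * nik + (1 : ℝ) * nik * Z + (-2 : ℝ) * nik * nT +
            (-1 : ℝ) * nik * nik + (1 : ℝ) * nj * nT + (1 : ℝ) * nj * nik + (1 : ℝ) * nk * nT + (1 : ℝ) * nk * nik)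
            * z) h_sum, (by positivity : (0:ℝ) ≤ (1 : ℝ) * (nE + ni + nj + nk) * (nE + ni + nj + nk) * (nik + nT) +
            (1 : ℝ) * (nij + njk) * (nik + nT) * (Z + nE + ni + nj + nk))]
  · -- pair_P12_P12
    linarith only [h_ut_12, congrArg (fun z : ℝ => ((1 : ℝ) * nE * nT + (1 : ℝ) * nE * njk + (1 : ℝ) * nT * Z +
            (-1 : ℝ) * nT * nT + (1 : ℝ) * ni * nT + (1 : ℝ) * ni * njk + (1 : ℝ) * nj * nT + (1 : ℝ) * nj * njk +
            (1 : ℝ) * njk * Z + (-2 : ℝ) * njk * nT + (-1 : ℝ) * njk * njk + (1 : ℝ) * nk * nT + (1 : ℝ) * nk *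
            njk) * z) h_sum, (by positivity : (0:ℝ) ≤ (1 : ℝ) * (nE + ni + nj + nk) * (nE + ni + nj + nk) *
            (njk + nT) + (1 : ℝ) * (nij + nik) * (njk + nT) * (Z + nE + ni + nj + nk))]
  · -- pair_P01_R0
    linarith only [h_ut_01, congrArg (fun z : ℝ => ((1 : ℝ) * nE * nT + (1 : ℝ) * nE * nij + (1 : ℝ) * nT * Z +
            (-1 : ℝ) * nT * nT + (1 : ℝ) * nij * Z + (-2 : ℝ) * nij * nT + (-1 : ℝ) * nij * nij + (-1 : ℝ) * nij *
            nik + (-1 : ℝ) * nik * nT + (1 : ℝ) * nj * nT + (1 : ℝ) * nj * nij + (1 : ℝ) * nk * nT + (1 : ℝ) * nk *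
            nij) * z) h_sum, (by positivity : (0:ℝ) ≤ (1 : ℝ) * (nE + ni + nj + nk) * (nE + nj + nk) * (nij + nT) +
            (1 : ℝ) * njk * (nij + nT) * (Z + nE + ni + nj + nk))]
  · -- pair_P01_R1
    linarith only [h_ut_01, congrArg (fun z : ℝ => ((1 : ℝ) * nE * nT + (1 : ℝ) * nE * nij + (1 : ℝ) * nT * Z +
            (-1 : ℝ) * nT * nT + (1 : ℝ) * ni * nT + (1 : ℝ) * ni * nij + (1 : ℝ) * nij * Z + (-2 : ℝ) * nij * nT +
            (-1 : ℝ) * nij * nij + (-1 : ℝ) * nij * njk + (-1 : ℝ) * njk * nT + (1 : ℝ) * nk * nT + (1 : ℝ) * nk *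
            nij) * z) h_sum, (by positivity : (0:ℝ) ≤ (1 : ℝ) * (nE + ni + nj + nk) * (nij + nT) *
            (nE + ni + nk + nik) + (1 : ℝ) * nik * Z * (nij + nT))]
  · -- pair_P02_R0
    linarith only [h_ut_02, congrArg (fun z : ℝ => ((1 : ℝ) * nE * nT + (1 : ℝ) * nE * nik + (1 : ℝ) * nT * Z +
            (-1 : ℝ) * nT * nT + (-1 : ℝ) * nij * nT + (-1 : ℝ) * nij * nik + (1 : ℝ) * nik * Z + (-2 : ℝ) * nik *
            nT + (-1 : ℝ) * nik * nik + (1 : ℝ) * nj * nT + (1 : ℝ) * nj * nik + (1 : ℝ) * nk * nT + (1 : ℝ) * nk *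
            nik) * z) h_sum, (by positivity : (0:ℝ) ≤ (1 : ℝ) * (nE + ni + nj + nk) * (nik + nT) *
            (nE + nj + nk + njk) + (1 : ℝ) * njk * Z * (nik + nT))]
  · -- pair_P02_R2
    linarith only [h_ut_02, congrArg (fun z : ℝ => ((1 : ℝ) * nE * nT + (1 : ℝ) * nE * nik + (1 : ℝ) * nT * Z +
            (-1 : ℝ) * nT * nT + (1 : ℝ) * ni * nT + (1 : ℝ) * ni * nik + (1 : ℝ) * nik * Z + (-2 : ℝ) * nik * nT +
            (-1 : ℝ) * nik * nik + (-1 : ℝ) * nik * njk + (1 : ℝ) * nj * nT + (1 : ℝ) * nj * nik + (-1 : ℝ) * njk *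
            nT) * z) h_sum, (by positivity : (0:ℝ) ≤ (1 : ℝ) * (nE + ni + nj + nk) * (nik + nT) *
            (nE + ni + nj + nij) + (1 : ℝ) * nij * Z * (nik + nT))]
  · -- pair_P12_R1
    linarith only [h_ut_12, congrArg (fun z : ℝ => ((1 : ℝ) * nE * nT + (1 : ℝ) * nE * njk + (1 : ℝ) * nT * Z +
            (-1 : ℝ) * nT * nT + (1 : ℝ) * ni * nT + (1 : ℝ) * ni * njk + (-1 : ℝ) * nij * nT + (-1 : ℝ) * nij *
            njk + (1 : ℝ) * njk * Z + (-2 : ℝ) * njk * nT + (-1 : ℝ) * njk * njk + (1 : ℝ) * nk * nT + (1 : ℝ) * nk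
            * njk) * z) h_sum, (by positivity : (0:ℝ) ≤ (1 : ℝ) * (nE + ni + nj + nk) * (njk + nT) *
            (nE + ni + nk + nik) + (1 : ℝ) * nik * Z * (njk + nT))]
  · -- pair_P12_R2
    linarith only [h_ut_12, congrArg (fun z : ℝ => ((1 : ℝ) * nE * nT + (1 : ℝ) * nE * njk + (1 : ℝ) * nT * Z +
            (-1 : ℝ) * nT * nT + (1 : ℝ) * ni * nT + (1 : ℝ) * ni * njk + (-1 : ℝ) * nik * nT + (-1 : ℝ) * nik *
            njk + (1 : ℝ) * nj * nT + (1 : ℝ) * nj * njk + (1 : ℝ) * njk * Z + (-2 : ℝ) * njk * nT + (-1 : ℝ) * njk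
            * njk) * z) h_sum, (by positivity : (0:ℝ) ≤ (1 : ℝ) * (nE + ni + nj + nk) * (nE + ni + nj) * (njk + nT)
            + (1 : ℝ) * nij * (njk + nT) * (Z + nE + ni + nj + nk))]

end Summit.CriticalPhenomena.PercolationContinuityZ3.Theorems.SahiE3MajCert
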